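import Summits.BirchSwinnertonDyer.Rank1Residual.Additive.CyclotomicTowerSelmerDualRestriction
import Summits.BirchSwinnertonDyer.BirchSwinnertonDyer.Theorems.QuadraticBranchSignedControlNoFiniteSubmoduleOfKO13Tower
import HarnessLib

/-!
# The K8 node (R2±) `NoFiniteSubmoduleSigned` and its binder `PublishedInputKO13`'s printed-shape fact
# (Kitajima–Otsuki 2018 Main Thm. 1.3, `F = ℚ`) REDUCED BY NAME to Thm. 4.5 on the CLASSICAL dual
# `X(V/ℚ(μ_{p^∞}))` + [Gre99] Thm. 1.7 + Prop. 3.32 — the §4.2 layer being kernel-proved on the tree's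
# objects (`Additive.CyclotomicTowerSelmerDualRestriction`) (cell `bsd-potss`, seat `bsd-potss-k8q-c5` g2;
# route `QuadraticBranchSignedControl`, items stmt-BirchSwinnertonDyer-19117 / 19222 / 19233 / 19301)

HONEST FRAMING (cell `bsd-potss`, run/shared/lean/pub/bsd-potss/): THEOREMS ONLY, all CONDITIONAL —
nothing here closes an item. The three (R2±) items are settled by citation through the binder
`PublishedInputKO13 := KitajimaOtsuki2018.mainThm13_etaSignedSelmerDual_noFiniteSubmodule`, itself a
theorem of the two printed-shape whole-dual facts (`…mainThm13_towerSignedSelmerDual_noFiniteSubmodule`,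
`Kobayashi2003.thm22_towerSignedSelmerDual_finite_torsion`; g0's `…NoFiniteSubmoduleOfKO13Tower`). THIS
FILE shows that the first of these is, in turn, a THEOREM of two displayed statements about the
CLASSICAL Selmer dual over Kobayashi's tower — (I) Kitajima–Otsuki Thm. 4.5 (= Main Thm. I) for
`F = ℚ` and (L) [Gre99] Thm. 1.7 ∧ Kitajima–Otsuki Prop. 3.32 (with the left half of (4.2)) — because
§4.2 of the paper (Prop. 4.6 + Prop. 4.7 ⟹ Thm. 4.8) is now proved in the kernel on the tree's own
objects. So the trusted text behind (R2±) is, BY NAME: §4.1 (Thm. 4.5 ← Matsuno 2003 Prop. 4.1),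
[Gre99] Thm. 1.7, §3 (Prop. 3.32), Kobayashi Thm. 2.2. NOTHING of these is asserted here; BSD is not
proved by any of this; no label / mark / count moves.

References: [KitajimaOtsuki2018] Main Thm. 1.3 (= Thm. 4.8), Thm. 4.5, Prop. 3.32, (4.2), Prop. 4.6,
Prop. 4.7, Remark 1.4 (5) (arXiv:1607.03612 pp. 3–4, 17–19); [GreenbergLNM1716] Thm. 1.7, pp. 104–105;
[Kobayashi2003] Def. 2.1, Thm. 2.2 (p. 5).
-/

set_option autoImplicit false
-- `Summit.BirchSwinnertonDyer.BirchSwinnertonDyer.…` is the lane's mandated namespace (sub = summit).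
set_option linter.dupNamespace false

noncomputable section

open scoped Classical

open WeierstrassCurve Field Literature.NumberTheory.EllipticCurves
  Literature.NumberTheory.GaloisRepresentations ZpExtension
  Summit.BirchSwinnertonDyer.Rank1Residual Summit.BirchSwinnertonDyer.Rank1Residual.Additive

namespace Summit.BirchSwinnertonDyer.BirchSwinnertonDyer.Theorems

open Summit.BirchSwinnertonDyer.BirchSwinnertonDyer.Theses.QuadraticBranchSignedControl

/-! ## §1 The binder's printed-shape fact from (I) Thm. 4.5 and (L) [Gre99] 1.7 ∧ Prop. 3.32 -/

/-- **Kitajima–Otsuki's Main Thm. 1.3 for `F = ℚ` in its printed shape (the whole dual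
`X^ε(V/ℚ(μ_{p^∞}))`, the named fact `KitajimaOtsuki2018.mainThm13_towerSignedSelmerDual_noFiniteSubmodule`
behind the K8 binder `PublishedInputKO13`) is a THEOREM of two displayed statements on the CLASSICAL
dual `X(V/ℚ(μ_{p^∞}))`** (any datum `Dc : Additive.TowerSelmerDualData V κ K₀ γ`): (I) = Thm. 4.5
(= Main Thm. I) for `F = ℚ` — `X(V/ℚ(μ_{p^∞}))` has no non-zero finite `Λ`-submodule (its printed
hypothesis "both `Sel^±(F_∞, E[p^∞])^∨` are `Λ`-torsion" is Kobayashi's Thm. 2.2 for `F = ℚ`, Remark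
1.4 (5), and is not displayed — flag `KO18-F=Q-Rem14(5)`, the binder's own); (L) = [Gre99] Thm. 1.7
(`rank_Λ X(V/ℚ(μ_{p^∞})) ≥ [ℚ_p(μ_p) : ℚ_p] = p − 1`) ∧ Prop. 3.32 with the left half of (4.2) (the
annihilator of `Sel^ε` in `X` is the image of a `Λ`-linear `Λ^{p−1} → X`: it is the image of
`(H¹(F_{∞,v}, E[p^∞]) / E^ε(F_{∞,v}) ⊗ ℚ_p/ℤ_p)^∨ ≅ Λ^{⊕[F_{0,v}:ℚ_p]}`). Given (I) and (L), §4.2 — Prop.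
4.6 (`ι^ε` injective) + Prop. 4.7 (Greenberg's lemma), kernel-proved on the objects as
`Additive.TowerSignedSelmerDualData.forall_finite_eq_bot_of_towerSelmerDual` — discharges the fact for
every sign `ε` and every datum `D` (the classical datum being the construction `towerSelmerDualData`;
`κ` is onto on `Gal(ℚ̄/ℚ(μ_p))` by `kappa_surjOn_galRange_cyclotomic`). NOTHING of (I), (L) is asserted.
[cite: KitajimaOtsuki2018, Main Thm. 1.3 (= Thm. 4.8), Thm. 4.5, Prop. 3.32, (4.2), Remark 1.4 (5) (arXiv:1607.03612 pp. 3–4, 17–19)]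
[cite: GreenbergLNM1716, Thm. 1.7] [cite: Kobayashi2003, Thm. 2.2 (p. 5)] -/
theorem mainThm13_tower_of_mainThmI_of_local
    (hI : ∀ (p : ℕ) [Fact p.Prime] (K₀ : Type) [Field K₀] [NumberField K₀]
        [IsCyclotomicExtension {p} ℚ K₀] [(galRange (K := ℚ) K₀).Normal],
      ∀ (V : WeierstrassCurve ℚ) [V.IsElliptic] [V.IsGloballyMinimal],
        p ≠ 2 → V.HasGoodReductionAtPrime p → V.frobeniusTrace p = 0 →
      ∀ (κ : ZpExtension ℚ p) (γ : Field.absoluteGaloisGroup ℚ),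
        κ.IsCyclotomic → κ.IsTopGenerator γ → γ ∈ galRange (K := ℚ) K₀ →
      ∀ (Dc : Additive.TowerSelmerDualData V κ K₀ γ),
        ∀ N : Submodule (IwasawaAlgebra p) Dc.X, Finite N → N = ⊥)
    (hL : ∀ (p : ℕ) [Fact p.Prime] (K₀ : Type) [Field K₀] [NumberField K₀]
        [IsCyclotomicExtension {p} ℚ K₀] [(galRange (K := ℚ) K₀).Normal],
      ∀ (V : WeierstrassCurve ℚ) [V.IsElliptic] [V.IsGloballyMinimal],
        p ≠ 2 → V.HasGoodReductionAtPrime p → V.frobeniusTrace p = 0 →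
      ∀ (κ : ZpExtension ℚ p) (γ : Field.absoluteGaloisGroup ℚ),
        κ.IsCyclotomic → κ.IsTopGenerator γ → γ ∈ galRange (K := ℚ) K₀ →
      ∀ (ε : ℤˣ) (Dc : Additive.TowerSelmerDualData V κ K₀ γ),
        ((p - 1 : ℕ) : Cardinal) ≤ Module.rank (IwasawaAlgebra p) Dc.X ∧
        ∃ ι : (Fin (p - 1) → IwasawaAlgebra p) →ₗ[IwasawaAlgebra p] Dc.X,
          ∀ x : Dc.X, x ∈ LinearMap.range ι ↔
            ∀ (s : V.subgroupH1 p (Additive.towerTopSubgroup κ K₀))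
              (hs : s ∈ Additive.towerSignedSelmerInfty V κ K₀ ℚ_[p] ε),
              Dc.toDual x ⟨s, Additive.towerSignedSelmerInfty_le_towerSelmerInfty V κ K₀ ℚ_[p] ε hs⟩ = 0) :
    Literature.NumberTheory.EllipticCurves.KitajimaOtsuki2018.mainThm13_towerSignedSelmerDual_noFiniteSubmodule := by
  intro p _ K₀ _ _ _ _ V _ _ hp hgood hap κ γ hκ hγ hγ₀ ε D' _ htor M hM
  have hK₀ := Additive.kappa_surjOn_galRange_cyclotomic κ K₀
  -- the classical datum (existence) and the Literature signed datum read on the Summits side (`rfl`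
  -- on every field, as `TowerReadingsOfLiterature.ofLiterature`)
  let Dc : Additive.TowerSelmerDualData V κ K₀ γ := Additive.towerSelmerDualData V κ K₀ hK₀ hγ hγ₀
  let D : Additive.TowerSignedSelmerDualData V κ K₀ ℚ_[p] γ ε :=
    ⟨D'.X, D'.conj_mem, D'.toDual, D'.bijective, D'.toDual_T_smul, D'.toDual_C_smul⟩
  obtain ⟨hrank, ι, hι⟩ := hL p K₀ V hp hgood hap κ γ hκ hγ hγ₀ ε Dc
  exact Additive.TowerSignedSelmerDualData.forall_finite_eq_bot_of_towerSelmerDual V κ K₀ ℚ_[p] ε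
    hK₀ hγ hγ₀ Dc D (hI p K₀ V hp hgood hap κ γ hκ hγ hγ₀ Dc) hrank ι hι htor M hM

/-! ## §2 The K8 node (R2±) from (I), (L) and Kobayashi's Thm. 2.2 -/

/-- **(R2±) the K8 node `NoFiniteSubmoduleSigned` (item stmt-BirchSwinnertonDyer-19117; hence its sign
items 19222 / 19233 by `noFiniteSubmodulePlus_of_signed` / `noFiniteSubmoduleMinus_of_signed`) from
(I) Kitajima–Otsuki Thm. 4.5 on the CLASSICAL dual, (L) [Gre99] Thm. 1.7 ∧ Prop. 3.32, and Kobayashi's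
Thm. 2.2 on the whole signed duals** — §1 composed with g0's `noFiniteSubmoduleSigned_of_mainThm13Tower`
(the `η`-descent + the twist dictionaries). CONDITIONAL on the three displayed statements; closes
nothing by itself. After this file the node's trusted inputs are, by name: Thm. 4.5 (§4.1 ← Matsuno 2003
Prop. 4.1), [Gre99] Thm. 1.7, Prop. 3.32 (§3), Kobayashi Thm. 2.2 — Kitajima–Otsuki's §4.2 is in the kernel.
[cite: KitajimaOtsuki2018, Main Thm. 1.3 (= Thm. 4.8), Thm. 4.5, Prop. 3.32 (arXiv:1607.03612 pp. 3, 17–19)]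
[cite: GreenbergLNM1716, Thm. 1.7] [cite: Kobayashi2003, Thm. 2.2 (p. 5)] -/
theorem noFiniteSubmoduleSigned_of_mainThmI_of_local_of_kobayashi22
    (hI : ∀ (p : ℕ) [Fact p.Prime] (K₀ : Type) [Field K₀] [NumberField K₀]
        [IsCyclotomicExtension {p} ℚ K₀] [(galRange (K := ℚ) K₀).Normal],
      ∀ (V : WeierstrassCurve ℚ) [V.IsElliptic] [V.IsGloballyMinimal],
        p ≠ 2 → V.HasGoodReductionAtPrime p → V.frobeniusTrace p = 0 →
      ∀ (κ : ZpExtension ℚ p) (γ : Field.absoluteGaloisGroup ℚ),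
        κ.IsCyclotomic → κ.IsTopGenerator γ → γ ∈ galRange (K := ℚ) K₀ →
      ∀ (Dc : Additive.TowerSelmerDualData V κ K₀ γ),
        ∀ N : Submodule (IwasawaAlgebra p) Dc.X, Finite N → N = ⊥)
    (hL : ∀ (p : ℕ) [Fact p.Prime] (K₀ : Type) [Field K₀] [NumberField K₀]
        [IsCyclotomicExtension {p} ℚ K₀] [(galRange (K := ℚ) K₀).Normal],
      ∀ (V : WeierstrassCurve ℚ) [V.IsElliptic] [V.IsGloballyMinimal],
        p ≠ 2 → V.HasGoodReductionAtPrime p → V.frobeniusTrace p = 0 →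
      ∀ (κ : ZpExtension ℚ p) (γ : Field.absoluteGaloisGroup ℚ),
        κ.IsCyclotomic → κ.IsTopGenerator γ → γ ∈ galRange (K := ℚ) K₀ →
      ∀ (ε : ℤˣ) (Dc : Additive.TowerSelmerDualData V κ K₀ γ),
        ((p - 1 : ℕ) : Cardinal) ≤ Module.rank (IwasawaAlgebra p) Dc.X ∧
        ∃ ι : (Fin (p - 1) → IwasawaAlgebra p) →ₗ[IwasawaAlgebra p] Dc.X,
          ∀ x : Dc.X, x ∈ LinearMap.range ι ↔
            ∀ (s : V.subgroupH1 p (Additive.towerTopSubgroup κ K₀))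
              (hs : s ∈ Additive.towerSignedSelmerInfty V κ K₀ ℚ_[p] ε),
              Dc.toDual x ⟨s, Additive.towerSignedSelmerInfty_le_towerSelmerInfty V κ K₀ ℚ_[p] ε hs⟩ = 0)
    (h22 : Literature.NumberTheory.EllipticCurves.Kobayashi2003.thm22_towerSignedSelmerDual_finite_torsion) :
    NoFiniteSubmoduleSigned :=
  noFiniteSubmoduleSigned_of_mainThm13Tower (mainThm13_tower_of_mainThmI_of_local hI hL) h22

end Summit.BirchSwinnertonDyer.BirchSwinnertonDyer.Theorems

end
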